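import Mathlib
import Summits.KontsevichZagierPeriods.KontsevichZagierPeriods.Theorems.InverseLandauTateFamilyKernelCurves
import Summits.KontsevichZagierPeriods.KontsevichZagierPeriods.Theorems.InverseLandauTateFamilyKernelRationalCertificate
import Summits.KontsevichZagierPeriods.KontsevichZagierPeriods.Theorems.InverseLandauTateFamilyKernelStubAssembly
import Summits.KontsevichZagierPeriods.KontsevichZagierPeriods.Theorems.InverseLandauTateFamilyKernelStubFaceIntegral
import Summits.KontsevichZagierPeriods.KontsevichZagierPeriods.Theorems.InverseLandauTateFamilyKernelOpenCube
import Summits.KontsevichZagierPeriods.KontsevichZagierPeriods.Theorems.InverseLandauTateFamilyKernelStubExactDescent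

/-!
# Crux `TateFamilyKernel` (stmt-KontsevichZagierPeriods-9130), line `Sketch` — stub `stub_exactFibreTwo`

Dimension `2` of the lead's skeleton of the crux
`Summit.KontsevichZagierPeriods.KontsevichZagierPeriods.Theses.InverseLandau.TateFamilyKernel`
(route `InverseLandau`): EXACTNESS AT THE FIBRE SUFFICES. If the fibre `F = P/Q(·, ϖ₀)` at a
real-algebraic `ϖ₀` is exact on the closed square with `ℚ(ϖ₀)`-rational data regular there,
`F = Σ_k ∂_{i_k} G_k`, `G_k = A_k/D_k(·, ϖ₀)`, and `∫_{(0,1)²} F = 0`, then every tame cube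
representation of `F` is a Kontsevich–Zagier relation.

* The BAKER STEP `faceSum_mem_relations`: the summed face differences
  `u(x) = Σ_k (G_k(x|^{i_k} 1) − G_k(x|^{i_k} 0))` on `[0,1]¹` form a one-variable rational function
  `p/q` with real-algebraic coefficients (real polynomials with real-algebraic coefficients = the
  subring `Polynomial.liftsRing` of the integral closure of `ℚ` in `ℝ`; the face substitutions
  `X_{i_k} ↦ c`, `X_{other} ↦ X`, `X_ϖ ↦ ϖ₀` land in it), pole-free on `[0,1]`; if `∫_{[0,1]} u = 0`,
  every tame cube representation of `u` is a relation by the transfer `algCoeffKernelDimOne`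
  (Baker; `Theorems/InverseLandauTateFamilyKernelCurves.lean`) and the open-cube bridge.
* `stub_exactFibreTwo`: `∫_{[0,1]¹} u = ∫_{[0,1]²} Σ_k ∂_{i_k} G_k = ∫_{[0,1]²} F = 0` (divergence
  theorem `stub_faceIntegral`, closed versus open square), then the abstract exact descent
  `tame_exactDescent` (`Theorems/InverseLandauTateFamilyKernelStubExactDescent.lean`: Ayoub elements,
  coordinate swaps, the lift of `u`) in dimension `0 + 2`.

No named fact, no new definition.
-/

noncomputable section
open MeasureTheory Set MvPolynomial
open Literature.NumberTheory.Transcendental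
open Literature.ModelTheory.ExponentialFields (IsSemialgebraic)
namespace Summit.KontsevichZagierPeriods.InverseLandau.TateFamilyKernel.Descent

/-! ### Real polynomials with real-algebraic coefficients -/

/-- A real polynomial has real-algebraic coefficients iff it lifts to the integral closure of `ℚ`
in `ℝ`. [folklore] -/
theorem isAlgebraic_coeff_iff_mem_liftsRing (p : Polynomial ℝ) :
    (∀ n, IsAlgebraic ℚ (p.coeff n)) ↔
      p ∈ Polynomial.liftsRing (algebraMap (integralClosure ℚ ℝ) ℝ) := by
  rw [← Polynomial.lifts_iff_liftsRing, Polynomial.lifts_iff_coeff_lifts]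
  refine forall_congr' fun n => ?_
  rw [Subalgebra.setRange_algebraMap, SetLike.mem_coe, mem_integralClosure_iff,
    isAlgebraic_iff_isIntegral]

/-- Constant real polynomials with real-algebraic value have real-algebraic coefficients.
[folklore] -/
theorem C_mem_liftsRing_of_isAlgebraic {c : ℝ} (hc : IsAlgebraic ℚ c) :
    Polynomial.C c ∈ Polynomial.liftsRing (algebraMap (integralClosure ℚ ℝ) ℝ) :=
  (isAlgebraic_coeff_iff_mem_liftsRing _).1 fun n => by
    rw [Polynomial.coeff_C]
    split_ifs
    · exact hc
    · exact isAlgebraic_zero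

/-- Substituting real polynomials with real-algebraic coefficients into a `ℚ`-polynomial gives a
real polynomial with real-algebraic coefficients. [folklore] -/
theorem aeval_mem_liftsRing {m : ℕ} {f : Fin m → Polynomial ℝ}
    (hf : ∀ l, f l ∈ Polynomial.liftsRing (algebraMap (integralClosure ℚ ℝ) ℝ))
    (S : MvPolynomial (Fin m) ℚ) :
    MvPolynomial.aeval f S ∈ Polynomial.liftsRing (algebraMap (integralClosure ℚ ℝ) ℝ) := by
  induction S using MvPolynomial.induction_on with
  | C a =>
    rw [MvPolynomial.aeval_C, Polynomial.algebraMap_apply]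
    exact C_mem_liftsRing_of_isAlgebraic (isAlgebraic_algebraMap a)
  | add p q hp hq =>
    rw [map_add]
    exact add_mem hp hq
  | mul_X p l hp =>
    rw [map_mul, MvPolynomial.aeval_X]
    exact mul_mem hp (hf l)

/-- Evaluating a substitution of real polynomials into a `ℚ`-polynomial is substituting the
values. [folklore] -/
theorem eval_mvPolynomial_aeval {m : ℕ} (f : Fin m → Polynomial ℝ) (S : MvPolynomial (Fin m) ℚ)
    (s : ℝ) :
    (MvPolynomial.aeval f S).eval s = MvPolynomial.aeval (fun l => (f l).eval s) S := by
  induction S using MvPolynomial.induction_on with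
  | C a => simp [Polynomial.algebraMap_apply]
  | add p q hp hq => simp [hp, hq]
  | mul_X p l hp => simp [hp]

/-! ### The face substitutions of the square -/

/-- The face substitution `X_j ↦ c`, `X_{other} ↦ X`, `X_ϖ ↦ ϖ₀` has real-algebraic coefficients
when `c` and `ϖ₀` are real algebraic. [folklore] -/
theorem faceSubst_mem_liftsRing (j : Fin 2) {c ϖ₀ : ℝ} (hc : IsAlgebraic ℚ c)
    (hϖ₀ : IsAlgebraic ℚ ϖ₀) (l : Fin (2 + 1)) :
    (Fin.snoc (Fin.insertNth j (Polynomial.C c) (fun _ : Fin 1 => Polynomial.X)) (Polynomial.C ϖ₀) :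
        Fin (2 + 1) → Polynomial ℝ) l ∈
      Polynomial.liftsRing (algebraMap (integralClosure ℚ ℝ) ℝ) := by
  refine Fin.lastCases ?_ (fun l' => ?_) l
  · simp only [Fin.snoc_last]
    exact C_mem_liftsRing_of_isAlgebraic hϖ₀
  · simp only [Fin.snoc_castSucc]
    refine Fin.succAboveCases j ?_ (fun t => ?_) l'
    · simp only [Fin.insertNth_apply_same]
      exact C_mem_liftsRing_of_isAlgebraic hc
    · simp only [Fin.insertNth_apply_succAbove]
      exact (Polynomial.lifts_iff_liftsRing _ _).1 (Polynomial.X_mem_lifts _)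

/-- The face substitution evaluated at `s = x 0` is evaluation at the face point
`(x|^j c, ϖ₀) = Fin.snoc (Fin.insertNth j c x) ϖ₀`. [folklore] -/
theorem eval_aeval_faceSubst (j : Fin 2) (c ϖ₀ : ℝ) (S : MvPolynomial (Fin (2 + 1)) ℚ)
    (x : Fin 1 → ℝ) :
    (MvPolynomial.aeval (Fin.snoc (Fin.insertNth j (Polynomial.C c) (fun _ : Fin 1 => Polynomial.X))
        (Polynomial.C ϖ₀) : Fin (2 + 1) → Polynomial ℝ) S).eval (x 0) =
      MvPolynomial.aeval (Fin.snoc (Fin.insertNth j c x) ϖ₀ : Fin (2 + 1) → ℝ) S := by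
  rw [eval_mvPolynomial_aeval]
  refine congrArg (fun v : Fin (2 + 1) → ℝ => MvPolynomial.aeval v S) ?_
  funext l
  refine Fin.lastCases ?_ (fun l' => ?_) l
  · simp only [Fin.snoc_last, Polynomial.eval_C]
  · simp only [Fin.snoc_castSucc]
    refine Fin.succAboveCases j ?_ (fun t => ?_) l'
    · simp only [Fin.insertNth_apply_same, Polynomial.eval_C]
    · simp only [Fin.insertNth_apply_succAbove, Polynomial.eval_X]
      exact congrArg x (Subsingleton.elim 0 t)

/-! ### Integrals over the closed and the open cube; partial fractions -/

/-- Closed cube versus open cube for set integrals: the faces are Lebesgue-null (the lead's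
`setIntegral_cube_eq_setIntegral_pi_Ioo`). [folklore] -/
theorem integral_cube_eq_integral_pi_Ioo {M : ℕ} (f : (Fin M → ℝ) → ℝ) :
    ∫ w in KZ.cube M, f w = ∫ w in Set.pi Set.univ (fun _ : Fin M => Ioo (0 : ℝ) 1), f w := by
  -- adapted from Cruxes/TateFamilyKernel/Lines/Sketch.lean (`setIntegral_cube_eq_setIntegral_pi_Ioo`)
  refine setIntegral_congr_set ?_
  rw [pi_univ_Ioo_eq_openUnitCube]
  refine (ae_eq_set).2 ⟨?_, ?_⟩
  · exact Summit.KontsevichZagierPeriods.FurushoPentagon.PentagonInKZ.SimplexToCube.volume_cube_diff_openUnitCube M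
  · exact measure_mono_null (fun x hx => (hx.2 (KZ.openUnitCube_subset_cube hx.1)).elim) measure_empty

/-- Partial fractions with a common denominator: `(Σ_k a_k ∏_{k' ≠ k} d_{k'}) / ∏_k d_k = Σ_k a_k/d_k`
when no `d_k` vanishes. [folklore] -/
theorem sum_mul_prod_erase_div_prod {K : ℕ} (a d : Fin K → ℝ) (hd : ∀ k, d k ≠ 0) :
    (∑ k, a k * ∏ k' ∈ Finset.univ.erase k, d k') / ∏ k, d k = ∑ k, a k / d k := by
  rw [Finset.sum_div]
  refine Finset.sum_congr rfl fun k _ => ?_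
  rw [← Finset.mul_prod_erase Finset.univ d (Finset.mem_univ k)]
  exact mul_div_mul_right (a k) (d k) (Finset.prod_ne_zero_iff.2 fun k' _ => hd k')

/-! ### The Baker step -/

/-- **The summed face differences are a relation (Baker).** For `ℚ`-polynomials `A_k, D_k` in the
two square variables and the parameter, a real-algebraic `ϖ₀` with `D_k(·, ϖ₀) ≠ 0` on `[0,1]²`,
and directions `i_k`, put `G_k = A_k/D_k(·, ϖ₀)` and `u(x) = Σ_k (G_k(x|^{i_k} 1) − G_k(x|^{i_k} 0))`
on `[0,1]¹`. If `∫_{[0,1]} u = 0`, every tame cube representation of `u` is a relation: `u` is a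
one-variable rational function `p/q` with real-algebraic coefficients (`q = ∏_k D_k|₁ D_k|₀`),
pole-free on `[0,1]`, with `∫₀¹ p/q = 0`, so its honest open-interval restriction is a relation by
the transfer `algCoeffKernelDimOne`, and the closed cube differs by null faces.
[cite: Baker1975, Thm. 2.1] -/
theorem faceSum_mem_relations (K : ℕ) (i : Fin K → Fin 2)
    (A Dn : Fin K → MvPolynomial (Fin (2 + 1)) ℚ) (ϖ₀ : ℝ) (halg : IsAlgebraic ℚ ϖ₀)
    (hDn : ∀ k, ∀ w ∈ KZ.cube 2, aeval (Fin.snoc w ϖ₀ : Fin (2 + 1) → ℝ) (Dn k) ≠ 0)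
    (hint : ∫ x in KZ.cube 1, ∑ k,
      (aeval (Fin.snoc (Fin.insertNth (i k) 1 x) ϖ₀ : Fin (2 + 1) → ℝ) (A k) /
          aeval (Fin.snoc (Fin.insertNth (i k) 1 x) ϖ₀ : Fin (2 + 1) → ℝ) (Dn k) -
        aeval (Fin.snoc (Fin.insertNth (i k) 0 x) ϖ₀ : Fin (2 + 1) → ℝ) (A k) /
          aeval (Fin.snoc (Fin.insertNth (i k) 0 x) ϖ₀ : Fin (2 + 1) → ℝ) (Dn k)) = 0)
    (U : KZ.IntegralRep 1) (hU : U.IsTameCube)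
    (hUi : ∀ x ∈ KZ.cube 1, U.integrand x = ∑ k,
      (aeval (Fin.snoc (Fin.insertNth (i k) 1 x) ϖ₀ : Fin (2 + 1) → ℝ) (A k) /
          aeval (Fin.snoc (Fin.insertNth (i k) 1 x) ϖ₀ : Fin (2 + 1) → ℝ) (Dn k) -
        aeval (Fin.snoc (Fin.insertNth (i k) 0 x) ϖ₀ : Fin (2 + 1) → ℝ) (A k) /
          aeval (Fin.snoc (Fin.insertNth (i k) 0 x) ϖ₀ : Fin (2 + 1) → ℝ) (Dn k))) :
    KZ.of U ∈ KZ.relations := by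
  classical
  -- the face polynomials `ev k c S = S(X|^{i_k} c, ϖ₀) ∈ ℝ[X]` (real-algebraic coefficients)
  set ev : Fin K → ℝ → MvPolynomial (Fin (2 + 1)) ℚ → Polynomial ℝ := fun k c S => MvPolynomial.aeval
    (Fin.snoc (Fin.insertNth (i k) (Polynomial.C c) (fun _ : Fin 1 => Polynomial.X)) (Polynomial.C ϖ₀) :
      Fin (2 + 1) → Polynomial ℝ) S with hev
  have heve : ∀ k (c : ℝ) (S : MvPolynomial (Fin (2 + 1)) ℚ) (x : Fin 1 → ℝ), (ev k c S).eval (x 0) =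
      aeval (Fin.snoc (Fin.insertNth (i k) c x) ϖ₀ : Fin (2 + 1) → ℝ) S :=
    fun k c S x => eval_aeval_faceSubst (i k) c ϖ₀ S x
  have hevL : ∀ k (c : ℝ), IsAlgebraic ℚ c → ∀ S : MvPolynomial (Fin (2 + 1)) ℚ,
      ev k c S ∈ Polynomial.liftsRing (algebraMap (integralClosure ℚ ℝ) ℝ) :=
    fun k c hc S => aeval_mem_liftsRing (faceSubst_mem_liftsRing (i k) hc halg) S
  -- the face denominators do not vanish on `[0,1]¹`
  have hD1 : ∀ k, ∀ x ∈ KZ.cube 1, (ev k 1 (Dn k)).eval (x 0) ≠ 0 := fun k x hx => by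
    rw [heve]
    exact hDn k _ (insertNth_mem_cube (i k) ⟨zero_le_one, le_rfl⟩ hx)
  have hD0 : ∀ k, ∀ x ∈ KZ.cube 1, (ev k 0 (Dn k)).eval (x 0) ≠ 0 := fun k x hx => by
    rw [heve]
    exact hDn k _ (insertNth_mem_cube (i k) ⟨le_rfl, zero_le_one⟩ hx)
  -- the common denominator and the matching numerator; real-algebraic coefficients
  set q : Polynomial ℝ := ∏ k, (ev k 1 (Dn k) * ev k 0 (Dn k)) with hq
  set p : Polynomial ℝ := ∑ k, (ev k 1 (A k) * ev k 0 (Dn k) - ev k 1 (Dn k) * ev k 0 (A k)) *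
    ∏ k' ∈ Finset.univ.erase k, (ev k' 1 (Dn k') * ev k' 0 (Dn k')) with hp
  have hqalg : ∀ n, IsAlgebraic ℚ (q.coeff n) :=
    (isAlgebraic_coeff_iff_mem_liftsRing q).2 (prod_mem fun k _ =>
      mul_mem (hevL k 1 isAlgebraic_one _) (hevL k 0 isAlgebraic_zero _))
  have hpalg : ∀ n, IsAlgebraic ℚ (p.coeff n) :=
    (isAlgebraic_coeff_iff_mem_liftsRing p).2 (sum_mem fun k _ => mul_mem
      (sub_mem (mul_mem (hevL k 1 isAlgebraic_one _) (hevL k 0 isAlgebraic_zero _))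
        (mul_mem (hevL k 1 isAlgebraic_one _) (hevL k 0 isAlgebraic_zero _)))
      (prod_mem fun k' _ => mul_mem (hevL k' 1 isAlgebraic_one _) (hevL k' 0 isAlgebraic_zero _)))
  -- `p/q = u` on `[0,1]¹`
  have hpq : ∀ x ∈ KZ.cube 1, p.eval (x 0) / q.eval (x 0) = ∑ k,
      (aeval (Fin.snoc (Fin.insertNth (i k) 1 x) ϖ₀ : Fin (2 + 1) → ℝ) (A k) /
          aeval (Fin.snoc (Fin.insertNth (i k) 1 x) ϖ₀ : Fin (2 + 1) → ℝ) (Dn k) -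
        aeval (Fin.snoc (Fin.insertNth (i k) 0 x) ϖ₀ : Fin (2 + 1) → ℝ) (A k) /
          aeval (Fin.snoc (Fin.insertNth (i k) 0 x) ϖ₀ : Fin (2 + 1) → ℝ) (Dn k)) := by
    intro x hx
    have hpx : p.eval (x 0) = ∑ k, ((ev k 1 (A k)).eval (x 0) * (ev k 0 (Dn k)).eval (x 0) -
        (ev k 1 (Dn k)).eval (x 0) * (ev k 0 (A k)).eval (x 0)) *
          ∏ k' ∈ Finset.univ.erase k, ((ev k' 1 (Dn k')).eval (x 0) * (ev k' 0 (Dn k')).eval (x 0)) := by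
      simp only [hp, Polynomial.eval_finsetSum, Polynomial.eval_mul, Polynomial.eval_sub,
        Polynomial.eval_prod]
    have hqx : q.eval (x 0) = ∏ k, ((ev k 1 (Dn k)).eval (x 0) * (ev k 0 (Dn k)).eval (x 0)) := by
      simp only [hq, Polynomial.eval_prod, Polynomial.eval_mul]
    rw [hpx, hqx, sum_mul_prod_erase_div_prod
      (fun k => (ev k 1 (A k)).eval (x 0) * (ev k 0 (Dn k)).eval (x 0) -
        (ev k 1 (Dn k)).eval (x 0) * (ev k 0 (A k)).eval (x 0))
      (fun k => (ev k 1 (Dn k)).eval (x 0) * (ev k 0 (Dn k)).eval (x 0))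
      (fun k => mul_ne_zero (hD1 k x hx) (hD0 k x hx))]
    refine Finset.sum_congr rfl fun k _ => ?_
    rw [← div_sub_div _ _ (hD1 k x hx) (hD0 k x hx), heve, heve, heve, heve]
  -- `q` is pole-free on `[0,1]`
  have hq0 : ∀ t ∈ Icc (0 : ℝ) 1, q.eval t ≠ 0 := by
    intro t ht
    have hx : (fun _ : Fin 1 => t) ∈ KZ.cube 1 := fun _ => ht
    rw [hq, Polynomial.eval_prod]
    exact Finset.prod_ne_zero_iff.2 fun k _ => by
      rw [Polynomial.eval_mul]
      exact mul_ne_zero (hD1 k (fun _ => t) hx) (hD0 k (fun _ => t) hx)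
  -- `∫₀¹ p/q = ∫_{[0,1]¹} u = 0`
  have hint' : ∫ t in (0 : ℝ)..1, p.eval t / q.eval t = 0 := by
    rw [← setIntegral_fin_one_eq (fun t => p.eval t / q.eval t) zero_le_one, ← pi_univ_Ioo_eq,
      ← integral_cube_eq_integral_pi_Ioo, ← hint]
    exact setIntegral_congr_fun KZ.measurableSet_cube fun x hx => hpq x hx
  -- the honest restriction of `U` to the open interval is a relation (Baker)
  have hE : IsSemialgebraic ℚ (openUnitCube 1) := isSemialgebraic_openUnitCube
  have hEsub : openUnitCube 1 ⊆ U.domain := by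
    rw [hU.domain_eq]
    exact KZ.openUnitCube_subset_cube
  set r : KZ.IntegralRep 1 := U.restrict _ hE hEsub with hr
  have hrd : r.domain = Set.pi Set.univ (fun _ : Fin 1 => Ioo (0 : ℝ) 1) := by
    rw [pi_univ_Ioo_eq_openUnitCube]
    rfl
  have hrd' : r.domain = {x | x 0 ∈ Ioo (0 : ℝ) 1} := by rw [hrd, pi_univ_Ioo_eq]
  have hri : EqOn r.integrand (fun x => p.eval (x 0) / q.eval (x 0)) r.domain := by
    intro x hx
    have hx' : x ∈ KZ.cube 1 := by
      rw [hrd, pi_univ_Ioo_eq_openUnitCube] at hx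
      exact KZ.openUnitCube_subset_cube hx
    show U.integrand x = p.eval (x 0) / q.eval (x 0)
    rw [hUi x hx', hpq x hx']
  have hrrel : KZ.of r ∈ KZ.relations := algCoeffKernelDimOne p q hpalg hqalg hq0 hint' r hrd' hri
  -- closed versus open cube
  have hsub : KZ.of U - KZ.of r ∈ KZ.relations :=
    of_sub_of_mem_relations_of_domain_eq_cube U r hU.domain_eq hrd (fun _ _ => rfl)
  have : KZ.of U = (KZ.of U - KZ.of r) + KZ.of r := by abel
  rw [this]
  exact KZ.relations.add_mem hsub hrrel

/-! ### The stub -/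

/-- **Dimension `2`: exactness at the fibre suffices** (stub `stub_exactFibreTwo` of the crux
`TateFamilyKernel`, line `Sketch`). If the fibre `P/Q(·, ϖ₀)` at a real-algebraic `ϖ₀`
(`Q(·,ϖ₀) ≠ 0` on `[0,1]²`) has vanishing integral over the open square and is exact there with
`ℚ(ϖ₀)`-rational data regular on the closed square, `P/Q(·,ϖ₀) = Σ_k ∂_{i_k}(A_k/D_k)(·,ϖ₀)`, then
every tame cube representation of it is a relation: the Ayoub elements are relations, and the
summed boundary terms form a one-variable rational function with real-algebraic coefficients,
pole-free on `[0,1]`, with vanishing integral — a relation by the transfer `algCoeffKernelDimOne`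
(Baker). [cite: KontsevichZagier2001, §1.2] [cite: Baker1975, Thm. 2.1] -/
theorem stub_exactFibreTwo (K : ℕ) (i : Fin K → Fin 2) (P Q : MvPolynomial (Fin (2 + 1)) ℚ)
    (A Dn : Fin K → MvPolynomial (Fin (2 + 1)) ℚ) (ϖ₀ : ℝ) (halg : IsAlgebraic ℚ ϖ₀)
    (hQ : ∀ w ∈ KZ.cube 2, aeval (Fin.snoc w ϖ₀ : Fin (2 + 1) → ℝ) Q ≠ 0)
    (hDn : ∀ k, ∀ w ∈ KZ.cube 2, aeval (Fin.snoc w ϖ₀ : Fin (2 + 1) → ℝ) (Dn k) ≠ 0)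
    (hexact : ∀ w ∈ KZ.cube 2,
      aeval (Fin.snoc w ϖ₀ : Fin (2 + 1) → ℝ) P / aeval (Fin.snoc w ϖ₀ : Fin (2 + 1) → ℝ) Q =
        ∑ k, aeval (Fin.snoc w ϖ₀ : Fin (2 + 1) → ℝ)
            (pderiv (Fin.castSucc (i k)) (A k) * Dn k - A k * pderiv (Fin.castSucc (i k)) (Dn k)) /
          aeval (Fin.snoc w ϖ₀ : Fin (2 + 1) → ℝ) (Dn k ^ 2))
    (hvan : ∫ z in Set.pi Set.univ (fun _ : Fin 2 => Ioo (0 : ℝ) 1),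
      aeval (Fin.snoc z ϖ₀ : Fin (2 + 1) → ℝ) P / aeval (Fin.snoc z ϖ₀ : Fin (2 + 1) → ℝ) Q = 0) :
    ∀ Φ : KZ.IntegralRep 2, Φ.IsTameCube →
      (∀ z ∈ KZ.cube 2, Φ.integrand z =
        aeval (Fin.snoc z ϖ₀ : Fin (2 + 1) → ℝ) P / aeval (Fin.snoc z ϖ₀ : Fin (2 + 1) → ℝ) Q) →
      KZ.of Φ ∈ KZ.relations := by
  have _ := hQ
  intro Φ hΦ hΦi
  have h1c : ((1 : ℚ) : ℝ) ∈ Icc (0 : ℝ) 1 := by norm_num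
  have h0c : ((0 : ℚ) : ℝ) ∈ Icc (0 : ℝ) 1 := by norm_num
  /- Step 1: the slices `G_k = A_k/D_k(·, ϖ₀)` and their partial derivatives `G'_k`. -/
  set G : Fin K → (Fin 2 → ℝ) → ℝ := fun k w =>
    aeval (Fin.snoc w ϖ₀ : Fin (2 + 1) → ℝ) (A k) / aeval (Fin.snoc w ϖ₀ : Fin (2 + 1) → ℝ) (Dn k)
    with hG
  set G' : Fin K → (Fin 2 → ℝ) → ℝ := fun k w =>
    aeval (Fin.snoc w ϖ₀ : Fin (2 + 1) → ℝ)
        (pderiv (Fin.castSucc (i k)) (A k) * Dn k - A k * pderiv (Fin.castSucc (i k)) (Dn k)) /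
      aeval (Fin.snoc w ϖ₀ : Fin (2 + 1) → ℝ) (Dn k ^ 2) with hG'
  have hD2 : ∀ k, ∀ w ∈ KZ.cube 2, aeval (Fin.snoc w ϖ₀ : Fin (2 + 1) → ℝ) (Dn k ^ 2) ≠ 0 :=
    fun k w hw => by rw [map_pow]; exact pow_ne_zero 2 (hDn k w hw)
  have hGa : ∀ k, AnalyticOnNhd ℝ (G k) (KZ.cube 2) := fun k =>
    analyticOnNhd_slice (A k) (Dn k) ϖ₀ (hDn k)
  have hGs : ∀ k, IsSemialgebraicFunOn ℚ (KZ.cube 2) (G k) := fun k =>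
    isSemialgebraicFunOn_slice (A k) (Dn k) halg (hDn k)
  have hG'a : ∀ k, AnalyticOnNhd ℝ (G' k) (KZ.cube 2) := fun k => analyticOnNhd_slice _ _ ϖ₀ (hD2 k)
  have hG's : ∀ k, IsSemialgebraicFunOn ℚ (KZ.cube 2) (G' k) := fun k =>
    isSemialgebraicFunOn_slice _ _ halg (hD2 k)
  have hder : ∀ k, ∀ w ∈ KZ.cube 2,
      HasDerivAt (fun t : ℝ => G k (Function.update w (i k) t)) (G' k w) (w (i k)) :=
    fun k w hw => hasDerivAt_slice_update (A k) (Dn k) ϖ₀ (i k) w (hDn k w hw)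
  /- Step 2: the summed face differences `u` on `[0,1]¹` are tame. -/
  set u : (Fin 1 → ℝ) → ℝ := fun x =>
    ∑ k, (G k (Fin.insertNth (i k) 1 x) - G k (Fin.insertNth (i k) 0 x)) with hu
  have hfa : ∀ k (c : ℝ), c ∈ Icc (0 : ℝ) 1 →
      AnalyticOnNhd ℝ (fun x : Fin 1 → ℝ => G k (Fin.insertNth (i k) c x)) (KZ.cube 1) :=
    fun k c hc => analyticOnNhd_comp_insertNth (hGa k) (i k) hc
  have hua : AnalyticOnNhd ℝ u (KZ.cube 1) := Finset.analyticOnNhd_fun_sum _ fun k _ x hx =>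
    (hfa k 1 ⟨zero_le_one, le_rfl⟩ x hx).sub (hfa k 0 ⟨le_rfl, zero_le_one⟩ x hx)
  have hus : IsSemialgebraicFunOn ℚ (KZ.cube 1) u :=
    IsSemialgebraicFunOn.fun_finsetSum _ KZ.isSemialgebraic_cube fun k _ => by
      have h1 := isSemialgebraicFunOn_comp_insertNth (hGs k) (i k) (c := 1) h1c
      have h0 := isSemialgebraicFunOn_comp_insertNth (hGs k) (i k) (c := 0) h0c
      simp only [Rat.cast_one, Rat.cast_zero] at h1 h0
      exact IsSemialgebraicFunOn.sub_holds h1 h0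
  /- Step 3: `∫_{[0,1]¹} u = ∫_{[0,1]²} Σ_k G'_k = ∫_{[0,1]²} F = ∫_{(0,1)²} F = 0`. -/
  have hIi : ∀ k (c : ℝ), c ∈ Icc (0 : ℝ) 1 →
      IntegrableOn (fun x : Fin 1 → ℝ => G k (Fin.insertNth (i k) c x)) (KZ.cube 1) :=
    fun k c hc => (hfa k c hc).continuousOn.integrableOn_compact KZ.isCompact_cube
  have hIs : ∀ k, IntegrableOn
      (fun x : Fin 1 → ℝ => G k (Fin.insertNth (i k) 1 x) - G k (Fin.insertNth (i k) 0 x)) (KZ.cube 1) :=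
    fun k => (hIi k 1 ⟨zero_le_one, le_rfl⟩).sub (hIi k 0 ⟨le_rfl, zero_le_one⟩)
  have hI1 : ∫ x in KZ.cube 1, u x = ∑ k, ((∫ x in KZ.cube 1, G k (Fin.insertNth (i k) 1 x)) -
      ∫ x in KZ.cube 1, G k (Fin.insertNth (i k) 0 x)) := by
    simp only [hu]
    rw [integral_finsetSum _ fun k _ => hIs k]
    exact Finset.sum_congr rfl fun k _ =>
      integral_sub (hIi k 1 ⟨zero_le_one, le_rfl⟩) (hIi k 0 ⟨le_rfl, zero_le_one⟩)
  have hI2 : ∫ w in KZ.cube 2, ∑ k, G' k w = ∑ k, ((∫ x in KZ.cube 1, G k (Fin.insertNth (i k) 1 x)) -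
      ∫ x in KZ.cube 1, G k (Fin.insertNth (i k) 0 x)) :=
    stub_faceIntegral Finset.univ i (fun k _ => hGa k) (fun k _ => hder k) fun k _ => (hG'a k).continuousOn
  have hI3 : ∫ w in KZ.cube 2, ∑ k, G' k w =
      ∫ w in KZ.cube 2, aeval (Fin.snoc w ϖ₀ : Fin (2 + 1) → ℝ) P / aeval (Fin.snoc w ϖ₀ : Fin (2 + 1) → ℝ) Q :=
    setIntegral_congr_fun KZ.measurableSet_cube fun w hw => (hexact w hw).symm
  have hI4 : ∫ w in KZ.cube 2,
      aeval (Fin.snoc w ϖ₀ : Fin (2 + 1) → ℝ) P / aeval (Fin.snoc w ϖ₀ : Fin (2 + 1) → ℝ) Q = 0 := by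
    rw [integral_cube_eq_integral_pi_Ioo]
    exact hvan
  have hint : ∫ x in KZ.cube 1, u x = 0 := by rw [hI1, ← hI2, hI3, hI4]
  /- Step 4: every tame representation of `u` is a relation (Baker), hence, by the abstract exact
  descent in dimension `0 + 2`, so is every tame representation of `Σ_k G'_k = P/Q(·, ϖ₀)`. -/
  have hurel : ∀ U : KZ.IntegralRep 1, U.IsTameCube → (∀ x ∈ KZ.cube 1, U.integrand x = u x) →
      KZ.of U ∈ KZ.relations := fun U hU hUi =>
    faceSum_mem_relations K i A Dn ϖ₀ halg hDn hint U hU hUi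
  exact tame_exactDescent i hGa hGs hG'a hG's hder hua hus hurel (fun x _ => rfl) Φ hΦ
    fun w hw => (hΦi w hw).trans ((hexact w hw).trans rfl)

end Summit.KontsevichZagierPeriods.InverseLandau.TateFamilyKernel.Descent

end
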